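import Summits.AtomisticToContinuum.FouriersLaw.Theses.HonestZwanzig

/-!
# HonestZwanzig / OrthogonalOhm — stub F `G0PosDef`, part 1: coordinate slices of the generator

Support file for crux item `stmt-AtomisticToContinuum-12693` (`HonestZwanzig.OrthogonalOhm`, sub-problem
`FouriersLaw`), line `Sketch`, registered stub `stub_G0PosDef` (positive definiteness of the zero-frequency
energy Gram matrix `G(0)`).

The analytic half of the stub (part 3) reduces `ξᵀ G(0) ξ = 0` to: the smooth Poisson solution `v` of
`L v = -(u - m)`, `u = ∑ₓ ξₓ eₓ` an energy profile of the symmetrically split site energies, has `∂_{p_0} v ≡ 0`.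
Parts 1–2 are the purely ALGEBRAIC bracket lemma turning this into `ξ = 0` (part 2,
`eq_zero_of_poisson_of_partialP_zero`).  This part is the coordinate calculus it needs, for an arbitrary
`OscillatorChain` with differentiable potentials and the tree's one-variable partial derivatives
`partialQ/partialP`:

* `partialP_slice_of_invP`, `partialQ_slice_of_invP`, `partialP_slice_of_invQ`, `partialQ_slice_of_invQ` — the
  coordinate partial derivatives of a function not depending on `p_k` (resp. `q_k`) do not depend on it either, and
  `∂_{p_k} v = 0` (resp. `∂_{q_k} v = 0`);
* `invP_of_partialP_eq_zero`, `invQ_of_partialQ_eq_zero` — conversely a differentiable `v` with `∂_{p_k} v ≡ 0`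
  (resp. `∂_{q_k} v ≡ 0`) does not depend on `p_k` (resp. `q_k`) (mean value theorem on the coordinate line);
* `dPotential_update_far`, `dPotential_update_succ` — how the force `∂Φ/∂q_i` moves with one position `q_k`
  (not at all at distance `≥ 2`; through `V'(q_{k+1} - q_k)` on the site `k + 1`);
* `generator_sliceP` — if `v` does not depend on `p_k`: `L v (q, p[k ↦ t]) = L v (q,p) + (t - p_k) ∂_{q_k} v (q,p)`;
* `generator_sliceQ` — if `v` does not depend on `q_k` and `∂_{p_{k-1}} v = ∂_{p_k} v ≡ 0`:
  `L v (q[k ↦ t], p) = L v (q,p) - (V'(q_{k+1} - t) - V'(q_{k+1} - q_k)) ∂_{p_{k+1}} v (q,p)`.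
-/

noncomputable section

open Finset
open Literature.MathematicalPhysics.KineticTheory.HeatConduction

namespace Summit.AtomisticToContinuum.FouriersLaw.Theorems.HonestZwanzig

namespace OrthogonalOhmLine.G0PosDef

variable {N : ℕ}

/-! ### Functions not depending on one coordinate -/

/-- If `v` does not depend on `p_k` then `∂_{p_k} v = 0`. -/
theorem partialP_eq_zero_of_invP {v : PhaseSpace N → ℝ} {k : Fin N}
    (hk : ∀ (x : PhaseSpace N) (t : ℝ), v (x.1, Function.update x.2 k t) = v x) (x : PhaseSpace N) :
    partialP k v x = 0 := by
  unfold partialP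
  have h : (fun t => v (x.1, Function.update x.2 k t)) = fun _ => v x := funext fun t => hk x t
  rw [h, deriv_const]

/-- If `v` does not depend on `q_k` then `∂_{q_k} v = 0`. -/
theorem partialQ_eq_zero_of_invQ {v : PhaseSpace N → ℝ} {k : Fin N}
    (hk : ∀ (x : PhaseSpace N) (t : ℝ), v (Function.update x.1 k t, x.2) = v x) (x : PhaseSpace N) :
    partialQ k v x = 0 := by
  unfold partialQ
  have h : (fun t => v (Function.update x.1 k t, x.2)) = fun _ => v x := funext fun t => hk x t
  rw [h, deriv_const]

/-- If `v` does not depend on `p_k`, neither does any `∂_{p_i} v`. -/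
theorem partialP_slice_of_invP {v : PhaseSpace N → ℝ} {k : Fin N}
    (hk : ∀ (x : PhaseSpace N) (t : ℝ), v (x.1, Function.update x.2 k t) = v x) (i : Fin N)
    (x : PhaseSpace N) (t : ℝ) :
    partialP i v (x.1, Function.update x.2 k t) = partialP i v x := by
  by_cases hik : i = k
  · subst hik
    rw [partialP_eq_zero_of_invP hk, partialP_eq_zero_of_invP hk]
  · unfold partialP
    have h : (fun s => v (x.1, Function.update (Function.update x.2 k t) i s)) =
        fun s => v (x.1, Function.update x.2 i s) := by
      funext s
      rw [Function.update_comm (Ne.symm hik)]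
      exact hk (x.1, Function.update x.2 i s) t
    simp only [h, Function.update_of_ne hik]

/-- If `v` does not depend on `p_k`, neither does any `∂_{q_i} v`. -/
theorem partialQ_slice_of_invP {v : PhaseSpace N → ℝ} {k : Fin N}
    (hk : ∀ (x : PhaseSpace N) (t : ℝ), v (x.1, Function.update x.2 k t) = v x) (i : Fin N)
    (x : PhaseSpace N) (t : ℝ) :
    partialQ i v (x.1, Function.update x.2 k t) = partialQ i v x := by
  unfold partialQ
  have h : (fun s => v (Function.update x.1 i s, Function.update x.2 k t)) =
      fun s => v (Function.update x.1 i s, x.2) := by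
    funext s
    exact hk (Function.update x.1 i s, x.2) t
  simp only [h]

/-- If `v` does not depend on `q_k`, neither does any `∂_{q_i} v`. -/
theorem partialQ_slice_of_invQ {v : PhaseSpace N → ℝ} {k : Fin N}
    (hk : ∀ (x : PhaseSpace N) (t : ℝ), v (Function.update x.1 k t, x.2) = v x) (i : Fin N)
    (x : PhaseSpace N) (t : ℝ) :
    partialQ i v (Function.update x.1 k t, x.2) = partialQ i v x := by
  by_cases hik : i = k
  · subst hik
    rw [partialQ_eq_zero_of_invQ hk, partialQ_eq_zero_of_invQ hk]
  · unfold partialQ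
    have h : (fun s => v (Function.update (Function.update x.1 k t) i s, x.2)) =
        fun s => v (Function.update x.1 i s, x.2) := by
      funext s
      rw [Function.update_comm (Ne.symm hik)]
      exact hk (Function.update x.1 i s, x.2) t
    simp only [h, Function.update_of_ne hik]

/-- If `v` does not depend on `q_k`, neither does any `∂_{p_i} v`. -/
theorem partialP_slice_of_invQ {v : PhaseSpace N → ℝ} {k : Fin N}
    (hk : ∀ (x : PhaseSpace N) (t : ℝ), v (Function.update x.1 k t, x.2) = v x) (i : Fin N)
    (x : PhaseSpace N) (t : ℝ) :
    partialP i v (Function.update x.1 k t, x.2) = partialP i v x := by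
  unfold partialP
  have h : (fun s => v (Function.update x.1 k t, Function.update x.2 i s)) =
      fun s => v (x.1, Function.update x.2 i s) := by
    funext s
    exact hk (x.1, Function.update x.2 i s) t
  simp only [h]

/-- **A differentiable `v` with `∂_{p_k} v ≡ 0` does not depend on `p_k`** (mean value theorem along the
`p_k`-line). -/
theorem invP_of_partialP_eq_zero {v : PhaseSpace N → ℝ} (hv : Differentiable ℝ v) {k : Fin N}
    (h : ∀ x, partialP k v x = 0) (x : PhaseSpace N) (t : ℝ) :
    v (x.1, Function.update x.2 k t) = v x := by
  set g : ℝ → ℝ := fun s => v (x.1, Function.update x.2 k s) with hg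
  have hupd : Differentiable ℝ (Function.update x.2 k) := fun s => (hasDerivAt_update x.2 k s).differentiableAt
  have hgd : Differentiable ℝ g := hv.comp ((differentiable_const x.1).prodMk hupd)
  have hg0 : ∀ s, deriv g s = 0 := by
    intro s
    have h1 := h (x.1, Function.update x.2 k s)
    unfold partialP at h1
    simpa only [Function.update_idem, Function.update_self] using h1
  have := is_const_of_deriv_eq_zero hgd hg0 t (x.2 k)
  simpa only [hg, Function.update_eq_self] using this

/-- **A differentiable `v` with `∂_{q_k} v ≡ 0` does not depend on `q_k`.** -/
theorem invQ_of_partialQ_eq_zero {v : PhaseSpace N → ℝ} (hv : Differentiable ℝ v) {k : Fin N}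
    (h : ∀ x, partialQ k v x = 0) (x : PhaseSpace N) (t : ℝ) :
    v (Function.update x.1 k t, x.2) = v x := by
  set g : ℝ → ℝ := fun s => v (Function.update x.1 k s, x.2) with hg
  have hupd : Differentiable ℝ (Function.update x.1 k) := fun s => (hasDerivAt_update x.1 k s).differentiableAt
  have hgd : Differentiable ℝ g := hv.comp (hupd.prodMk (differentiable_const x.2))
  have hg0 : ∀ s, deriv g s = 0 := by
    intro s
    have h1 := h (Function.update x.1 k s, x.2)
    unfold partialQ at h1
    simpa only [Function.update_idem, Function.update_self] using h1
  have := is_const_of_deriv_eq_zero hgd hg0 t (x.1 k)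
  simpa only [hg, Function.update_eq_self] using this

/-! ### How the force `∂Φ/∂q_i` moves with one position -/

/-- The force on a site at distance `≥ 2` from `k` does not depend on `q_k`. -/
theorem dPotential_update_far (P : OscillatorChain) {i k : Fin N} (h1 : i ≠ k) (h2 : i.val ≠ k.val + 1)
    (h3 : i.val + 1 ≠ k.val) (q : Fin N → ℝ) (t : ℝ) :
    P.dPotential N i (Function.update q k t) = P.dPotential N i q := by
  rw [P.dPotential_eq_closed, P.dPotential_eq_closed, Function.update_of_ne h1]
  have hne1 : ∀ hi : 0 < i.val, (⟨i.val - 1, by omega⟩ : Fin N) ≠ k := fun hi h =>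
    h2 (by have := congrArg Fin.val h; dsimp only at this; omega)
  have hne2 : ∀ hi : i.val + 1 < N, (⟨i.val + 1, hi⟩ : Fin N) ≠ k := fun hi h =>
    h3 (by have := congrArg Fin.val h; dsimp only at this; omega)
  by_cases hi : 0 < i.val <;> by_cases hi' : i.val + 1 < N
  · rw [dif_pos hi, dif_pos hi, dif_pos hi', dif_pos hi', Function.update_of_ne (hne1 hi),
      Function.update_of_ne (hne2 hi')]
  · rw [dif_pos hi, dif_pos hi, dif_neg hi', dif_neg hi', Function.update_of_ne (hne1 hi)]
  · rw [dif_neg hi, dif_neg hi, dif_pos hi', dif_pos hi', Function.update_of_ne (hne2 hi')]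
  · rw [dif_neg hi, dif_neg hi, dif_neg hi', dif_neg hi']

/-- The force on the site `c = k + 1` moves with `q_k` only through the bond `(k, c)`:
`∂Φ/∂q_c (q[k ↦ t]) = ∂Φ/∂q_c (q) + V'(q_c - t) - V'(q_c - q_k)`. -/
theorem dPotential_update_succ (P : OscillatorChain) {k c : Fin N} (hc : c.val = k.val + 1)
    (q : Fin N → ℝ) (t : ℝ) :
    P.dPotential N c (Function.update q k t) =
      P.dPotential N c q + (deriv P.V (q c - t) - deriv P.V (q c - q k)) := by
  have hck : c ≠ k := fun h => by rw [h] at hc; omega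
  have hc0 : 0 < c.val := by omega
  have hpred : (⟨c.val - 1, by omega⟩ : Fin N) = k := Fin.ext (by simp [hc])
  rw [P.dPotential_eq_closed, P.dPotential_eq_closed, Function.update_of_ne hck, dif_pos hc0, dif_pos hc0, hpred,
    Function.update_self]
  by_cases hN : c.val + 1 < N
  · have hne : (⟨c.val + 1, hN⟩ : Fin N) ≠ k := fun h => by
      have := congrArg Fin.val h; simp at this; omega
    rw [dif_pos hN, dif_pos hN, Function.update_of_ne hne]
    ring
  · rw [dif_neg hN, dif_neg hN]
    ring

/-! ### Slices of the generator -/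

section Generator

variable (P : OscillatorChain) (hU : Differentiable ℝ P.U) (hV : Differentiable ℝ P.V) (T_L T_R : ℝ)
include hU hV

/-- **The `p_k`-slice of `L v`** when `v` does not depend on `p_k`: along `p_k ↦ t` the generator image is
affine with slope `∂_{q_k} v`: `L v (q, p[k ↦ t]) = L v (q, p) + (t - p_k) ∂_{q_k} v (q, p)`. -/
theorem generator_sliceP {v : PhaseSpace N → ℝ} {k : Fin N}
    (hk : ∀ (x : PhaseSpace N) (t : ℝ), v (x.1, Function.update x.2 k t) = v x) (x : PhaseSpace N) (t : ℝ) :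
    P.generator N T_L T_R v (x.1, Function.update x.2 k t) =
      P.generator N T_L T_R v x + (t - x.2 k) * partialQ k v x := by
  have hQ : ∀ i, partialQ i v (x.1, Function.update x.2 k t) = partialQ i v x :=
    fun i => partialQ_slice_of_invP hk i x t
  have hP : ∀ i, partialP i v (x.1, Function.update x.2 k t) = partialP i v x :=
    fun i => partialP_slice_of_invP hk i x t
  have hPP : ∀ i, partialP i (partialP i v) (x.1, Function.update x.2 k t) = partialP i (partialP i v) x :=
    fun i => partialP_slice_of_invP (v := partialP i v) (fun y s => partialP_slice_of_invP hk i y s) i x t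
  have hH : ∀ i, partialQ i (P.hamiltonian N) (x.1, Function.update x.2 k t) = partialQ i (P.hamiltonian N) x := by
    intro i
    rw [P.partialQ_hamiltonian_eq_dPotential hU hV, P.partialQ_hamiltonian_eq_dPotential hU hV]
  have hPk : partialP k v x = 0 := partialP_eq_zero_of_invP hk x
  have h1 : ∀ i, Function.update x.2 k t i * partialQ i v x =
      x.2 i * partialQ i v x + (if i = k then (t - x.2 k) * partialQ k v x else 0) := by
    intro i
    by_cases hik : i = k
    · subst hik
      rw [Function.update_self, if_pos rfl]
      ring
    · rw [Function.update_of_ne hik, if_neg hik, add_zero]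
  have h2 : ∀ i, Function.update x.2 k t i * partialP i v x = x.2 i * partialP i v x := by
    intro i
    by_cases hik : i = k
    · subst hik
      rw [hPk, mul_zero, mul_zero]
    · rw [Function.update_of_ne hik]
  unfold OscillatorChain.generator
  simp only [hQ, hP, hPP, hH, h2]
  have hsum : ∑ i, (Function.update x.2 k t i * partialQ i v x - partialQ i (P.hamiltonian N) x * partialP i v x) =
      ∑ i, (x.2 i * partialQ i v x - partialQ i (P.hamiltonian N) x * partialP i v x) + (t - x.2 k) * partialQ k v x := by
    have : ∀ i ∈ (univ : Finset (Fin N)),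
        Function.update x.2 k t i * partialQ i v x - partialQ i (P.hamiltonian N) x * partialP i v x =
        (x.2 i * partialQ i v x - partialQ i (P.hamiltonian N) x * partialP i v x) +
          (if i = k then (t - x.2 k) * partialQ k v x else 0) := by
      intro i _
      rw [h1 i]
      ring
    rw [Finset.sum_congr rfl this, Finset.sum_add_distrib, Finset.sum_ite_eq' univ k, if_pos (mem_univ _)]
  rw [hsum]
  ring

/-- **The `q_k`-slice of `L v`** when `v` does not depend on `q_k` and `∂_{p_{k-1}} v = ∂_{p_k} v ≡ 0`: along
`q_k ↦ t` only the force of the bond `(k, k+1)` on site `c = k+1` moves: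
`L v (q[k ↦ t], p) = L v (q, p) - (V'(q_c - t) - V'(q_c - q_k)) ∂_{p_c} v (q, p)`. -/
theorem generator_sliceQ {v : PhaseSpace N → ℝ} {k c : Fin N} (hc : c.val = k.val + 1)
    (hk : ∀ (x : PhaseSpace N) (t : ℝ), v (Function.update x.1 k t, x.2) = v x)
    (hPk : ∀ x, partialP k v x = 0) (hPa : ∀ a : Fin N, a.val + 1 = k.val → ∀ x, partialP a v x = 0)
    (x : PhaseSpace N) (t : ℝ) :
    P.generator N T_L T_R v (Function.update x.1 k t, x.2) =
      P.generator N T_L T_R v x - (deriv P.V (x.1 c - t) - deriv P.V (x.1 c - x.1 k)) * partialP c v x := by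
  have hck : c ≠ k := fun h => by rw [h] at hc; omega
  have hQ : ∀ i, partialQ i v (Function.update x.1 k t, x.2) = partialQ i v x :=
    fun i => partialQ_slice_of_invQ hk i x t
  have hP : ∀ i, partialP i v (Function.update x.1 k t, x.2) = partialP i v x :=
    fun i => partialP_slice_of_invQ hk i x t
  have hPP : ∀ i, partialP i (partialP i v) (Function.update x.1 k t, x.2) = partialP i (partialP i v) x :=
    fun i => partialP_slice_of_invQ (v := partialP i v) (fun y s => partialP_slice_of_invQ hk i y s) i x t
  have hH : ∀ i, partialQ i (P.hamiltonian N) (Function.update x.1 k t, x.2) * partialP i v x =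
      partialQ i (P.hamiltonian N) x * partialP i v x +
        (if i = c then (deriv P.V (x.1 c - t) - deriv P.V (x.1 c - x.1 k)) * partialP c v x else 0) := by
    intro i
    rw [P.partialQ_hamiltonian_eq_dPotential hU hV, P.partialQ_hamiltonian_eq_dPotential hU hV]
    by_cases hic : i = c
    · subst hic
      rw [if_pos rfl, dPotential_update_succ P hc]
      ring
    rw [if_neg hic, add_zero]
    by_cases hik : i = k
    · subst hik
      rw [hPk, mul_zero, mul_zero]
    by_cases hia : i.val + 1 = k.val
    · rw [hPa i hia, mul_zero, mul_zero]
    have h2 : i.val ≠ k.val + 1 := fun h => hic (Fin.ext (by omega))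
    show P.dPotential N i (Function.update x.1 k t) * partialP i v x = P.dPotential N i x.1 * partialP i v x
    rw [dPotential_update_far P hik h2 hia]
  unfold OscillatorChain.generator
  simp only [hQ, hP, hPP]
  have hsum : ∑ i, (x.2 i * partialQ i v x - partialQ i (P.hamiltonian N) (Function.update x.1 k t, x.2) * partialP i v x) =
      ∑ i, (x.2 i * partialQ i v x - partialQ i (P.hamiltonian N) x * partialP i v x) -
        (deriv P.V (x.1 c - t) - deriv P.V (x.1 c - x.1 k)) * partialP c v x := by
    have : ∀ i ∈ (univ : Finset (Fin N)),
        x.2 i * partialQ i v x - partialQ i (P.hamiltonian N) (Function.update x.1 k t, x.2) * partialP i v x =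
        (x.2 i * partialQ i v x - partialQ i (P.hamiltonian N) x * partialP i v x) -
          (if i = c then (deriv P.V (x.1 c - t) - deriv P.V (x.1 c - x.1 k)) * partialP c v x else 0) := by
      intro i _
      rw [hH i]
      ring
    rw [Finset.sum_congr rfl this, Finset.sum_sub_distrib, Finset.sum_ite_eq' univ c, if_pos (mem_univ _)]
  rw [hsum]
  ring

end Generator

end OrthogonalOhmLine.G0PosDef

/-! ## Registered helper stub -/

open OrthogonalOhmLine.G0PosDef in
/-- **Registered helper stub of this file** (`helper_g0PosDefSliceP`, sub-goal of stub `stub_G0PosDef` of crux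
stmt-AtomisticToContinuum-12693): the `p_k`-slice of the generator image of a function not depending on `p_k`
(= `generator_sliceP`). -/
theorem helper_g0PosDefSliceP : ∀ (P : Literature.MathematicalPhysics.KineticTheory.HeatConduction.OscillatorChain), Differentiable ℝ P.U → Differentiable ℝ P.V → ∀ (N : ℕ) (T_L T_R : ℝ) (v : Literature.MathematicalPhysics.KineticTheory.HeatConduction.PhaseSpace N → ℝ) (k : Fin N), (∀ (x : Literature.MathematicalPhysics.KineticTheory.HeatConduction.PhaseSpace N) (t : ℝ), v (x.1, Function.update x.2 k t) = v x) → ∀ (x : Literature.MathematicalPhysics.KineticTheory.HeatConduction.PhaseSpace N) (t : ℝ), P.generator N T_L T_R v (x.1, Function.update x.2 k t) = P.generator N T_L T_R v x + (t - x.2 k) * Literature.MathematicalPhysics.KineticTheory.HeatConduction.partialQ k v x :=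
  fun P hU hV _ T_L T_R _ _ hk x t => generator_sliceP P hU hV T_L T_R hk x t

end Summit.AtomisticToContinuum.FouriersLaw.Theorems.HonestZwanzig

end
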